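import Summits.BirchSwinnertonDyer.Rank1Residual.Supersingular.X6RankZeroErratumDefs
import Summits.BirchSwinnertonDyer.Rank1Residual.Supersingular.X6RankZeroErratumInterface
import Literature.NumberTheory.EllipticCurves.Kobayashi2013.RankOneSupersingularUpperBound
import Literature.NumberTheory.EllipticCurves.Castella2018.AnticyclotomicControlTheorem
import Literature.NumberTheory.EllipticCurves.Castella2018.Section5Bookkeeping
import Literature.NumberTheory.EllipticCurves.Castella2018.TamagawaQuadraticBaseChangeProofs
import Literature.NumberTheory.EllipticCurves.CaiShuTian2014.ExplicitGrossZagier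
import Literature.NumberTheory.EllipticCurves.CastellaWan2024BDPDivisibilityAtTrivialCharacter
import Literature.NumberTheory.EllipticCurves.NonvanishingTwistsPrescribedRamificationSimpleZero
import Literature.NumberTheory.EllipticCurves.ManinConstantSemistablePrimewise
import Literature.NumberTheory.EllipticCurves.AnalyticRankModularityProofs
import Literature.NumberTheory.QuadraticFields.KroneckerSplitting
import HarnessLib

/-!
# Leaf `ClassX6 ∧ r_an = 0` — road (E) interface, part 2: the anticyclotomic pack from its EIGHT
# unproved primaries, and the discriminant parity of the rank-zero field supply at an ODD erratum
# prime (cell `bsd-print-x6`, typer seat `ty2`, gen 3)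

HONEST FRAMING (cell `bsd-print-x6`, run/shared/lean/pub/bsd-print-x6/README.md): the cell closes the
partition leaf `ClassX6 W p ∧ W.analyticRank = 0` BY NAME from cited theorems typed exactly. THIS
FILE asserts nothing about any curve, books nothing, introduces NO definition and NO named fact (debt
0); THEOREMS ONLY, a prover-side sibling of `X6RankZeroErratumInterface.lean` (that file is at the
400-line cap) over the light defs module `X6RankZeroErratumDefs.lean` (`HasErratumPrime`, the pack
`PublishedAcInputsX6Err`) which the route imports; THIS heavier file is never imported by the route.

* §1 **Two of the ten pack conjuncts are already theorems of the tree**, so the pack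
  `PublishedAcInputsX6Err` is assembled from EIGHT named facts: conjunct (2) `hasEntireLFunction_rat`
  from (3) modularity (`hasEntireLFunction_rat_of_exists_isNewformOf`, Diamond–Shurman Thm. 8.8.3 ⇐
  BCDT Thm. A), and conjunct (8) `Castella2018.section5_tamagawaRelation` OUTRIGHT
  (`Castella2018.section5_tamagawaRelation_holds`, `Castella2018/TamagawaQuadraticBaseChangeProofs.lean`:
  Kodaira–Néron and Tate place by place at `p ≥ 5` — the route's Input child for (8) closes by that
  name). The genuinely open antecedents of the `Err` child are therefore: GZK, modularity (newform),
  Mazur 1978 Cor. 4.1, Kobayashi 2013 Rem. 1.3 ∘ Kato, Castella 2018 Thm. 2.3, Cai–Shu–Tian 2014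
  Thm. 1.1, Friedberg–Hoffstein 1995 Thm. B (simple-zero clause), and the CW24 Thm. 5.3 ∘ Cas18
  Thm. 3.2 composite.
  (No by-name projections `pack ⇒ conjunct` and no alias of `section5_tamagawaRelation_holds` are
  filed here: a theorem whose type is a named fact reads as a discharge to the gate's debt counter;
  consumers destructure the pack or quote the Literature `_holds` name directly.)
* §2 **Discriminant parity of the supply field.** Castella 2018 Thm. 3.2 is typed parity-free
  (`Castella2018.thm32_exists_isBDPLFunction_valueAtOne`), but its printed proof ([BDP13 Thm. 5.13] /
  [Castella–Hsieh 2018]) is written for `d_K` ODD — the referee's second-level rider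
  `Cas18-Thm32-dK-odd@BDP13` (REFEREE.md PA-10c; census S-4: 103 of the 107 `Err` cells at `p ≥ 5` have
  an ODD erratum prime, 4 have only `q = 2`). On the rank-zero erratum-type shape delivered by the
  field supply (ramified at the erratum prime `q`, every other prime of `N_W` split, `2` split when
  `2 ∤ N_W`): `2` SPLITS in `K` as soon as `q ≠ 2` (either `2 ∣ N_W`, then `2 ≠ q` is "another prime
  of `N_W`", or `2 ∤ N_W`), hence `d_K ≡ 1 (mod 8)` (Kronecker: `2` splits iff `d_K ≡ 1 (mod 8)`,
  tree lemma `Quadratic.ncard_primesOver_two_eq_two_iff`), in particular `2 ∤ d_K`; and trivially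
  `2 ∣ d_K` when the ramified prime is `q = 2`. So a closure through Thm. 3.2 at the supply field of an
  ODD erratum prime is rider-free, by name: `X6RankZero.exists_erratumShapeField_oddDiscr_of_oddErratumPrime`.

ROUTE-INDEPENDENT: imports no `Theses` file and no `Theorems/PrintX6*` file.

References: [Castella2018] Thm. 3.2, §5 (arXiv:1704.06608 pp. 9, 12); [BertoliniDarmonPrasanna2013]
Thm. 5.13 (standing hypothesis `d_K` odd); [DiamondShurman2005] Thm. 8.8.3; [BreuilConradDiamondTaylor2001]
Thm. A; [FriedbergHoffstein1995] Thm. B; [Marcus1977] Ch. 3 (decomposition of `2` in a quadratic field).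
-/

set_option autoImplicit false

noncomputable section

open scoped Classical

open WeierstrassCurve NumberField IsDedekindDomain
  Literature.NumberTheory.EllipticCurves
  Literature.NumberTheory.EllipticCurves.ModularForms
  Literature.NumberTheory.EllipticCurves.Rank1Residual
  Literature.NumberTheory.EllipticCurves.Rank1Residual.Typed

namespace Summit.BirchSwinnertonDyer.Rank1Residual.Supersingular

/-! ### §1 The pack from its eight unproved primaries -/

section Primaries

/-- **The anticyclotomic input pack of the `Err` child from EIGHT named facts** — conjunct (2)
(`L(E,s)` entire) is modularity (3) read through Diamond–Shurman Thm. 8.8.3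
(`hasEntireLFunction_rat_of_exists_isNewformOf`), and conjunct (8) (Castella 2018 §5 Tamagawa
relation) is a THEOREM of the tree (`Castella2018.section5_tamagawaRelation_holds`). The remaining
binders are the genuinely open antecedents of road (E) in rank zero.
[cite: DiamondShurman2005, Thm. 8.8.3] [cite: Castella2018, §5 (arXiv:1704.06608 p. 12), Tamagawa relation] -/
theorem publishedAcInputsX6Err_of_primaries
    (hGZK : Literature.NumberTheory.EllipticCurves.rank_eq_analyticRank_of_analyticRank_le_one)
    (hnf : Literature.NumberTheory.EllipticCurves.ModularForms.exists_isNewformOf)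
    (hMaz : Literature.NumberTheory.EllipticCurves.ModularForms.mazur_not_dvd_maninConstant_of_odd)
    (hK13 : Literature.NumberTheory.EllipticCurves.Kobayashi2013.rem13_padicValRat_bsd_rank_one_le_of_kato)
    (h23 : Literature.NumberTheory.EllipticCurves.Castella2018.thm23_anticyclotomicControl)
    (hCST : Literature.NumberTheory.EllipticCurves.CaiShuTian2014.thm11_trivialChar)
    (hFH : Literature.NumberTheory.EllipticCurves.friedbergHoffstein_exists_twist_simpleZero_ramifiedAt_splitAt)
    (h53 : Literature.NumberTheory.EllipticCurves.castellaWan2024_thm53_castella2018_thm32_constantCoeff) :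
    PublishedAcInputsX6Err :=
  publishedAcInputsX6Err_of_facts hGZK (hasEntireLFunction_rat_of_exists_isNewformOf hnf) hnf hMaz hK13
    h23 hCST Literature.NumberTheory.EllipticCurves.Castella2018.section5_tamagawaRelation_holds hFH h53

end Primaries

/-! ### §2 Discriminant parity of the rank-zero erratum-type field -/

section Parity

variable {K : Type} [Field K] [NumberField K]

omit [NumberField K] in
/-- **On the erratum-type shape, `2` splits in `K` as soon as the ramified prime is odd**: with every
prime of `N_W` other than `q` split and `2` split when `2 ∤ N_W`, the prime `2 ≠ q` splits in either
case. [folklore] -/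
theorem erratumShape_two_split (W : WeierstrassCurve ℚ) {q : ℕ} (hq2 : q ≠ 2)
    (hsplit : ∀ ℓ : ℕ, ℓ.Prime → ℓ ∣ W.conductorNorm ℤ → ℓ ≠ q →
      ((Ideal.span {(ℓ : ℤ)}).primesOver (𝓞 K)).ncard = 2)
    (h2 : ¬ 2 ∣ W.conductorNorm ℤ → ((Ideal.span {(2 : ℤ)}).primesOver (𝓞 K)).ncard = 2) :
    ((Ideal.span {(2 : ℤ)}).primesOver (𝓞 K)).ncard = 2 := by
  by_cases h2N : 2 ∣ W.conductorNorm ℤ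
  · exact_mod_cast hsplit 2 Nat.prime_two h2N (Ne.symm hq2)
  · exact h2 h2N

/-- **`2` split in an imaginary quadratic `K` forces `d_K ≡ 1 (mod 8)`, in particular `d_K` odd**
(decomposition law at `2`; tree lemma `Quadratic.ncard_primesOver_two_eq_two_iff`).
[cite: Marcus1977, Ch. 3, Thm. 25] -/
theorem not_two_dvd_discr_of_two_split (hK : IsImaginaryQuadratic K)
    (h2 : ((Ideal.span {(2 : ℤ)}).primesOver (𝓞 K)).ncard = 2) :
    NumberField.discr K % 8 = 1 ∧ ¬ (2 : ℤ) ∣ NumberField.discr K := by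
  have h8 : NumberField.discr K % 8 = 1 :=
    (Literature.NumberTheory.QuadraticFields.Quadratic.ncard_primesOver_two_eq_two_iff hK.1).mp h2
  exact ⟨h8, fun hd ↦ by omega⟩

/-- Conversely, when the ramified prime of the shape is `q = 2`, the discriminant is EVEN (the four
census cells `65774b1, 145146q1, 220022c1, 476882e1 @ 5` whose only erratum prime is `2`, REFEREE.md
S-4, sit here: every supply field of theirs carries the rider). [folklore] -/
theorem two_dvd_discr_of_erratumShape_two (hqD : ((2 : ℕ) : ℤ) ∣ NumberField.discr K) :
    (2 : ℤ) ∣ NumberField.discr K := by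
  exact_mod_cast hqD

variable (W : WeierstrassCurve ℚ) [W.IsElliptic] [W.IsGloballyMinimal] (p : ℕ) [Fact p.Prime]

/-- **The rank-zero field supply at an ODD erratum prime delivers an ODD discriminant, by name.** For an
X6 pair `(W, p)` with `ord_{s=1} L(E,s) = 0` and an erratum prime `q ≠ 2` (nonsplit multiplicative,
`p ∤ ord_q Δ_min`): there is an imaginary quadratic `K` with `q ∣ d_K`, every other prime of `N_W`
split, `2` split (unconditionally), `p` split, `L(E^{(d_K)},1) = 0`, `L'(E^{(d_K)},1) ≠ 0`, AND
`d_K ≡ 1 (mod 8)`, `2 ∤ d_K` — the erratum SHAPE of `X6RankZero.exists_erratumShapeField_of_hasErratumPrime`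
(§5 of the Interface) plus the parity clause under which Castella 2018 Thm. 3.2's printed proof
([BDP13]) is written (referee rider `Cas18-Thm32-dK-odd@BDP13`). Hypotheses of the named fact `hFH`
discharged as in §5 (`w(E) = +1` ⇐ `r_an = 0` + modularity; `p ≠ q` ⇐ `p` good). CONDITIONAL on the
named fact `hFH` (PRINT-anchored, REF PA-9b); nothing booked.
[cite: FriedbergHoffstein1995, Thm. B, second alternative] [cite: DiaconuTian2005, §2.2 (p. 1357)]
[cite: Castella2018, Thm. 3.2 (arXiv:1704.06608 p. 9)] [cite: BertoliniDarmonPrasanna2013, Thm. 5.13] -/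
theorem X6RankZero.exists_erratumShapeField_oddDiscr_of_oddErratumPrime
    (hFH : friedbergHoffstein_exists_twist_simpleZero_ramifiedAt_splitAt) (hnf : exists_isNewformOf)
    (hX : ClassX6 W p) (hr : W.analyticRank = 0) (q : ℕ) [Fact q.Prime] (hq2 : q ≠ 2) (hq : Mult W q)
    (hqns : ¬ W.HasSplitMultiplicativeReductionAtPrime q) :
    ∃ (K : Type) (_ : Field K) (_ : NumberField K),
      IsImaginaryQuadratic K ∧ (q : ℤ) ∣ NumberField.discr K ∧
        (∀ ℓ : ℕ, ℓ.Prime → ℓ ∣ W.conductorNorm ℤ → ℓ ≠ q →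
          ((Ideal.span {(ℓ : ℤ)}).primesOver (𝓞 K)).ncard = 2) ∧
        ((Ideal.span {(2 : ℤ)}).primesOver (𝓞 K)).ncard = 2 ∧
        SatisfiesHeegnerHypothesis p K ∧
          (W.quadraticTwist (NumberField.discr K : ℚ)).entireLFunction 1 = 0 ∧
          deriv (W.quadraticTwist (NumberField.discr K : ℚ)).entireLFunction 1 ≠ 0 ∧
        NumberField.discr K % 8 = 1 ∧ ¬ (2 : ℤ) ∣ NumberField.discr K := by
  have hqp : q ≠ p := HasErratumPrime.ne_of_good hX.1.1 hq
  have hw : W.rootNumber = 1 := by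
    rw [WeierstrassCurve.rootNumber_eq_neg_one_pow_analyticRank_of_exists_isNewformOf hnf W, hr, pow_zero]
  obtain ⟨K, hF, hNF, hKiq, hqD, hsplit, h2, hHp, hL0, hL1⟩ :=
    exists_ramifiedAt_splitAt_twist_simpleZero hFH W hw q hq hqns (p := p) Fact.out hqp.symm
  have h2s : ((Ideal.span {(2 : ℤ)}).primesOver (𝓞 K)).ncard = 2 := erratumShape_two_split W hq2 hsplit h2
  obtain ⟨h8, hodd⟩ := not_two_dvd_discr_of_two_split hKiq h2s
  exact ⟨K, hF, hNF, hKiq, hqD, hsplit, h2s, hHp, hL0, hL1, h8, hodd⟩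

/-- **Corollary on the `Err` sub-class: an ODD erratum prime gives a rider-free supply field.** If
`HasErratumPrime W p` is witnessed by some `q ≠ 2`, the Interface's §5 conclusion holds with `2`
split and `2 ∤ d_K` added. [cite: FriedbergHoffstein1995, Thm. B, second alternative]
[cite: Castella2018, Thm. 3.2 (arXiv:1704.06608 p. 9)] -/
theorem X6RankZero.exists_erratumShapeField_oddDiscr_of_exists_odd
    (hFH : friedbergHoffstein_exists_twist_simpleZero_ramifiedAt_splitAt) (hnf : exists_isNewformOf)
    (hX : ClassX6 W p) (hr : W.analyticRank = 0)
    (h : ∃ q : ℕ, ∃ _ : Fact q.Prime, q ≠ 2 ∧ Mult W q ∧ ¬ W.HasSplitMultiplicativeReductionAtPrime q ∧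
      ¬ p ∣ padicValInt q W.minimalDiscriminantInt) :
    ∃ (q : ℕ) (_ : Fact q.Prime) (K : Type) (_ : Field K) (_ : NumberField K),
      q ≠ 2 ∧ Mult W q ∧ ¬ W.HasSplitMultiplicativeReductionAtPrime q ∧
        ¬ p ∣ padicValInt q W.minimalDiscriminantInt ∧ q ≠ p ∧ q ∣ W.conductorNorm ℤ ∧
      IsImaginaryQuadratic K ∧ (q : ℤ) ∣ NumberField.discr K ∧
        (∀ ℓ : ℕ, ℓ.Prime → ℓ ∣ W.conductorNorm ℤ → ℓ ≠ q →
          ((Ideal.span {(ℓ : ℤ)}).primesOver (𝓞 K)).ncard = 2) ∧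
        ((Ideal.span {(2 : ℤ)}).primesOver (𝓞 K)).ncard = 2 ∧
        SatisfiesHeegnerHypothesis p K ∧
          (W.quadraticTwist (NumberField.discr K : ℚ)).entireLFunction 1 = 0 ∧
          deriv (W.quadraticTwist (NumberField.discr K : ℚ)).entireLFunction 1 ≠ 0 ∧
        ¬ (2 : ℤ) ∣ NumberField.discr K := by
  obtain ⟨q, hqF, hq2, hq, hqns, hram⟩ := h
  have hqp : q ≠ p := HasErratumPrime.ne_of_good hX.1.1 hq
  have hqN : q ∣ W.conductorNorm ℤ :=
    (W.dvd_conductorNorm_iff_not_hasGoodReductionAtPrime q).mpr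
      (WeierstrassCurve.HasMultiplicativeReduction.not_hasGoodReduction (R := ℤ_[q]) hq)
  obtain ⟨K, hF, hNF, hKiq, hqD, hsplit, h2s, hHp, hL0, hL1, -, hodd⟩ :=
    X6RankZero.exists_erratumShapeField_oddDiscr_of_oddErratumPrime W p hFH hnf hX hr q hq2 hq hqns
  exact ⟨q, hqF, K, hF, hNF, hq2, hq, hqns, hram, hqp, hqN, hKiq, hqD, hsplit, h2s, hHp, hL0, hL1, hodd⟩

end Parity

end Summit.BirchSwinnertonDyer.Rank1Residual.Supersingular

end
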